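import Summits.Ventures.HodgeRepro2.T6N43Main

/-!
# T6N43Fock — the interface Prop (N4.3.P2) is sesquilinearity once f lies on the Fock line

Record: TIER5 §N4.3 row R3.7 («π₀,τ′_j := the U(W_A)_{τ′_j}-submodule of the Fock space generated by
φ_{A,τ′_j}, which is ALSO how π₀,τ′_j is defined in §10.4 … so f_{τ′_j} ↔ φ_{A,τ′_j} under the
identification») and (N4.3.P2), TIER5 v0.51 ll. 1284–1286 («a unitary isomorphism ψ_j from the closure of the Fock
submodule onto the Hilbert space of π₀,τ′_j with ψ_j(φ) = (‖φ‖/‖f‖)·f, and ⟨ω(g)φ, φ⟩ = (‖φ‖²/‖f‖²) ·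
⟨π₀(g)f, f⟩»). In kernel: if the datum's two coefficients are the diagonal matrix coefficients of ONE
action `ω` on a Hilbert space at two vectors `φ` and `f = c • φ` on the same line, then
`FockLineIdentification` holds by sesquilinearity (`fockLineIdentification_of_line`). Hence the
interface residual of (I-P2) at M2 is exactly the route's identification of π₀,τ′ with the Fock
submodule generated by φ (R3.7 / P2-quinquies, the [A] item of the record), not the coefficient
identity itself. Axioms: {propext, Classical.choice, Quot.sound}. §8(d): uses an L-value-free
non-vanishing device: NO.
-/

namespace Summit.Ventures.HodgeRepro2.T6

open scoped InnerProductSpace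

/-- The Fock-line datum: an action `ω` of `H` on a Hilbert space `E` (the Weil representation on the
Fock model restricted to `H = U(W_A)(ℝ)_{τ′}`), the Fock vector `φ` and the forced vector `f = c • φ`
on the line it spans (R3.7: the τ′-isotypic part of π₀,τ′ is one-dimensional, MEMO Lemma 15.7). -/
structure FockLineDatum (H : Type*) (E : Type*) [NormedAddCommGroup E] [InnerProductSpace ℂ E] where
  /-- the action `g ↦ ω(g)` -/
  ω : H → E →L[ℂ] E
  /-- the Fock vector `φ_{A,τ′}` -/
  φ : E
  /-- the forced vector `f_{τ′}` -/
  f : E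
  /-- the scalar with `f = c • φ` -/
  c : ℂ
  hf : f = c • φ

namespace ArchDoublingDatum

variable {H : Type*} [MeasurableSpace H] {P : Matrix (Fin 2) (Fin 2) ℂ → Prop}
  {E : Type*} [NormedAddCommGroup E] [InnerProductSpace ℂ E]

/-- (N4.3.P2) in kernel: a datum whose coefficients are `⟪φ, ω(g)φ⟫` and `⟪f, ω(g)f⟫` with `f = c • φ`
satisfies the Fock-line identification `coeffW = (‖φ‖²/‖f‖²) · coeffπ`. -/
theorem fockLineIdentification_of_line (𝒟 : ArchDoublingDatum H P) (F : FockLineDatum H E)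
    (hW : ∀ g, 𝒟.coeffW g = ⟪F.φ, F.ω g F.φ⟫_ℂ) (hπ : ∀ g, 𝒟.coeffπ g = ⟪F.f, F.ω g F.f⟫_ℂ)
    (hnφ : ‖F.φ‖ = 𝒟.normφ) (hnf : ‖F.f‖ = 𝒟.normf) : 𝒟.FockLineIdentification := by
  intro g
  have hnf' : 𝒟.normf ≠ 0 := 𝒟.normf_pos.ne'
  have hnφ' : 𝒟.normφ ≠ 0 := 𝒟.normφ_pos.ne'
  -- ‖f‖ = ‖c‖ ‖φ‖
  have hc : ‖F.c‖ = 𝒟.normf / 𝒟.normφ := by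
    rw [← hnf, ← hnφ, F.hf, norm_smul, mul_div_cancel_right₀ _ (hnφ ▸ hnφ')]
  have hπ' : 𝒟.coeffπ g = ((‖F.c‖ ^ 2 : ℝ) : ℂ) * 𝒟.coeffW g := by
    rw [hπ g, hW g, F.hf, map_smul, inner_smul_left, inner_smul_right, ← mul_assoc,
      Complex.conj_mul']
    push_cast
    ring
  rw [hπ', ← mul_assoc, ← Complex.ofReal_mul, hc, div_pow]
  have : 𝒟.normφ ^ 2 / 𝒟.normf ^ 2 * (𝒟.normf ^ 2 / 𝒟.normφ ^ 2) = 1 := by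
    field_simp
  rw [this, Complex.ofReal_one, one_mul]

/-- (N4.3.P2) at the compact place τ′₁ in kernel (TIER5 v0.51 l. 1284: «the Fock vector φ_{A,τ′_1} = Δ
spans a U(2)_W-type which is the ONE-dimensional representation det^{(m′₁−3)/2} … so the H_1-submodule
generated by φ is the character det^{(m′₁−3)/2} =: π₀,τ′_1, and ⟨ω(g)φ, φ⟩ = det(g)^{(m′₁−3)/2}‖φ‖²»):
if `φ` is a `det^m`-eigenvector of the action and `f = c • φ`, then `CharacterCoefficient 𝒟 m` holds.
The residual at τ′₁ is therefore the eigenvector statement (print: [KK07] Lemma 5.2(i) / 5.3(1)(i),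
R3.6–R3.7), not the coefficient identities. -/
theorem characterCoefficient_of_eigen (𝒟 : ArchDoublingDatum H P) (F : FockLineDatum H E) (m : ℤ)
    (hW : ∀ g, 𝒟.coeffW g = ⟪F.φ, F.ω g F.φ⟫_ℂ) (hπ : ∀ g, 𝒟.coeffπ g = ⟪F.f, F.ω g F.f⟫_ℂ)
    (heig : ∀ g, F.ω g F.φ = ((𝒟.rep g).det ^ m) • F.φ)
    (hnφ : ‖F.φ‖ = 𝒟.normφ) (hnf : ‖F.f‖ = 𝒟.normf) : 𝒟.CharacterCoefficient m := by
  have hφφ : ⟪F.φ, F.φ⟫_ℂ = ((‖F.φ‖ ^ 2 : ℝ) : ℂ) := by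
    exact_mod_cast inner_self_eq_norm_sq_to_K (𝕜 := ℂ) F.φ
  refine ⟨fun g => ?_, fun g => ?_⟩
  · rw [hW g, heig g, inner_smul_right, ← hnφ, hφφ]
  · have hcc : F.c * (starRingEnd ℂ) F.c = ((‖F.c‖ ^ 2 : ℝ) : ℂ) := by
      rw [Complex.mul_conj, Complex.normSq_eq_norm_sq]
    rw [hπ g, F.hf, map_smul, heig g, smul_comm, inner_smul_right, inner_smul_left,
      inner_smul_right, ← hnf, F.hf, norm_smul, mul_pow, hφφ,
      show (starRingEnd ℂ) F.c * (F.c * ((‖F.φ‖ ^ 2 : ℝ) : ℂ)) =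
        (F.c * (starRingEnd ℂ) F.c) * ((‖F.φ‖ ^ 2 : ℝ) : ℂ) by ring, hcc]
    push_cast
    ring

end ArchDoublingDatum

end Summit.Ventures.HodgeRepro2.T6
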